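import Literature.NumberTheory.NumberFields.CubicFieldExplicit
import Mathlib.NumberTheory.NumberField.Ideal.KummerDedekind
import Mathlib.Algebra.Polynomial.SpecificDegree
import HarnessLib

/-!
# Explicit cubic fields: `ℤ[X]/(f) ≅ 𝓞 K`, residue maps, Dedekind–Kummer, the Minkowski floor

Continuation of `CubicFieldExplicit.lean` (a number field `K` of degree `3` with a root `θ` of an
irreducible monic `f = X³ + aX² + bX + c ∈ ℤ[X]`, under the square-factor condition on `Δ(f)`
that makes `𝓞 K = ℤ[θ]`), generalising the tree's
`Literature/Topology/FourManifolds/CappellShanesonClassNumberOneLarge.lean` /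
`…ClassNumberTwoUnits.lean` from the family `X³ - aX² + (a-1)X - 1` to any monic cubic
(D. A. Marcus, *Number Fields*, 2nd ed. (2018), Ch. 3, Thm. 27 (Dedekind–Kummer); Ch. 5,
Cor. 2 of Thm. 37 (Minkowski bound)):

* `exists_ringEquiv_adjoinRoot`: `ℤ[X]/(f) ≃+* 𝓞 K`, root ↦ `θ`; hence
  `exists_ringHom_of_root`: for ANY commutative ring `S` and `t ∈ S` with `f(t) = 0` a ring
  homomorphism `𝓞 K →+* S`, `θ ↦ t` (residue maps to `ℤ/q` at degree-one primes, and reduction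
  maps to finite rings such as `(ℤ/4)[t]/(f)` at inert `2`);
* `exists_factor_of_mem_primesOver` (Dedekind–Kummer for `𝓞 K = ℤ[θ]`, Mathlib's
  `NumberField.Ideal.primesOverSpanEquivMonicFactorsMod`), `eq_span_of_no_root` (inert primes
  are `(p)`), `isPrincipal_of_unique_root` (split primes with a certified generator);
* (the cubic Minkowski floor bound and the two-generator principal-ideal certificate are the
  tree's `Literature.Topology.FourManifolds.floor_minkowskiBound_le_cubic` /
  `…span_pair_eq_span_singleton`, not repeated here).

Everything is proved; written for the explicit `2`-descents of
`Literature/Barriers/BirchSwinnertonDyer/RankNotSumOfLocalInvariantsF3Cubic*.lean`.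

## References

* [Marcus2018] D. A. Marcus, *Number Fields*, 2nd ed. (2018), Ch. 3, Thm. 27; Ch. 5, Thm. 37 and
  Cor. 2.
-/

noncomputable section

open Polynomial Module NumberField Ideal
open scoped NumberField

namespace Literature.NumberTheory.NumberFields

namespace MonicCubic

section Root

variable {K : Type*} [Field K] [NumberField K] {a b c : ℤ} {θ : K}

/-! ### `ℤ[X]/(f) ≅ 𝓞 K` and homomorphisms out of `𝓞 K` -/

/-- The Dedekind–Kummer conductor exponent of `θ` is `1` when `𝓞 K = ℤ[θ]`.
[cite: Marcus2018, Ch. 3, Thm. 27] -/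
theorem exponent_thetaInt (hirr : Irreducible (polyQ a b c)) (hθ : aeval θ (poly a b c) = 0)
    (h3 : finrank ℚ K = 3)
    (hsq : ∀ r e : ℤ, disc a b c = r ^ 2 * e → 2 < |e| → IsUnit r) :
    RingOfIntegers.exponent (thetaInt hθ) = 1 :=
  RingOfIntegers.exponent_eq_one_iff.mpr (adjoin_thetaInt_eq_top hirr hθ h3 hsq)

/-- **`ℤ[X]/(f) ≅ 𝓞 K = ℤ[θ]`**, the root going to `θ` (`minpoly_ℤ θ = f`, `ℤ[θ] = 𝓞 K`;
Mathlib's `minpoly.equivAdjoin`). [cite: Marcus2018, Ch. 2, Exercise 27] -/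
theorem exists_ringEquiv_adjoinRoot (hirr : Irreducible (polyQ a b c))
    (hθ : aeval θ (poly a b c) = 0) (h3 : finrank ℚ K = 3)
    (hsq : ∀ r e : ℤ, disc a b c = r ^ 2 * e → 2 < |e| → IsUnit r) :
    ∃ e : AdjoinRoot (poly a b c) ≃+* 𝓞 K,
      e (AdjoinRoot.root (poly a b c)) = thetaInt hθ := by
  have htop := adjoin_thetaInt_eq_top hirr hθ h3 hsq
  have key : ∀ g : ℤ[X], g = minpoly ℤ (thetaInt hθ) →
      ∃ e : AdjoinRoot g ≃+* 𝓞 K, e (AdjoinRoot.root g) = thetaInt hθ := by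
    intro g hg
    subst hg
    have hint : IsIntegral ℤ (thetaInt hθ) := Algebra.IsIntegral.isIntegral _
    let e₁ := minpoly.equivAdjoin hint
    let e₂ : Algebra.adjoin ℤ ({thetaInt hθ} : Set (𝓞 K)) ≃ₐ[ℤ] 𝓞 K :=
      (Subalgebra.equivOfEq _ _ htop).trans Subalgebra.topEquiv
    refine ⟨(e₁.trans e₂).toRingEquiv, ?_⟩
    have h1 :
        ((e₁ (AdjoinRoot.root _) : Algebra.adjoin ℤ ({thetaInt hθ} : Set (𝓞 K))) : 𝓞 K) =
          thetaInt hθ := by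
      change ((minpoly.equivAdjoin hint (AdjoinRoot.mk _ X) : Algebra.adjoin ℤ _) : 𝓞 K) = _
      rw [minpoly.coe_equivAdjoin]
      exact AdjoinRoot.Minpoly.coe_toAdjoin_mk_X
    have h2 : ∀ y, e₂ y = (y : 𝓞 K) := fun y => rfl
    calc (e₁.trans e₂).toRingEquiv (AdjoinRoot.root _) = e₂ (e₁ (AdjoinRoot.root _)) := rfl
      _ = ((e₁ (AdjoinRoot.root _) : Algebra.adjoin ℤ ({thetaInt hθ} : Set (𝓞 K))) :
          𝓞 K) := h2 _
      _ = thetaInt hθ := h1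
  exact key _ (minpoly_thetaInt hirr hθ).symm

/-- **Homomorphisms out of `𝓞 K = ℤ[θ]`**: for any commutative ring `S` and `t ∈ S` with
`t³ + at² + bt + c = 0` there is a ring homomorphism `ψ : 𝓞 K →+* S` with `ψ(θ) = t` (it is
`ℤ[X]/(f) → S`, `X ↦ t`, through `ℤ[X]/(f) ≅ 𝓞 K`). Used for residue maps `𝓞 K → ℤ/q` at
degree-one primes and reduction maps to finite rings at inert primes.
[cite: Marcus2018, Ch. 3, Thm. 27] -/
theorem exists_ringHom_of_root (hirr : Irreducible (polyQ a b c))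
    (hθ : aeval θ (poly a b c) = 0) (h3 : finrank ℚ K = 3)
    (hsq : ∀ r e : ℤ, disc a b c = r ^ 2 * e → 2 < |e| → IsUnit r)
    {S : Type*} [CommRing S] (t : S) (ht : t ^ 3 + (a : S) * t ^ 2 + (b : S) * t + (c : S) = 0) :
    ∃ ψ : 𝓞 K →+* S, ψ (thetaInt hθ) = t := by
  obtain ⟨e, he⟩ := exists_ringEquiv_adjoinRoot hirr hθ h3 hsq
  have hev : (poly a b c).eval₂ (Int.castRingHom S) t = 0 := by
    simp only [poly, eval₂_add, eval₂_mul, eval₂_X_pow, eval₂_C, eval₂_X,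
      Int.coe_castRingHom]
    exact ht
  refine ⟨(AdjoinRoot.lift (Int.castRingHom S) t hev).comp e.symm.toRingHom, ?_⟩
  rw [RingHom.comp_apply]
  change AdjoinRoot.lift _ _ hev (e.symm (thetaInt hθ)) = _
  rw [← he, e.symm_apply_apply, AdjoinRoot.lift_root]

/-! ### Primes above `p` via Dedekind–Kummer -/

/-- `f` modulo `p`. [folklore] -/
def polyMod (a b c : ℤ) (p : ℕ) : (ZMod p)[X] := (poly a b c).map (Int.castRingHom (ZMod p))

omit [NumberField K] in
/-- `f mod p` is monic. [folklore] -/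
theorem monic_polyMod (a b c : ℤ) (p : ℕ) [Fact p.Prime] : (polyMod a b c p).Monic :=
  (monic_poly a b c).map _

omit [NumberField K] in
/-- `f mod p` has degree `3`. [folklore] -/
theorem natDegree_polyMod (a b c : ℤ) (p : ℕ) [Fact p.Prime] :
    (polyMod a b c p).natDegree = 3 := by
  rw [polyMod, (monic_poly a b c).natDegree_map, natDegree_poly]

omit [NumberField K] in
/-- Evaluation of `f mod p`. [folklore] -/
theorem eval_polyMod (a b c : ℤ) (p : ℕ) (r : ZMod p) :
    (polyMod a b c p).eval r = r ^ 3 + (a : ZMod p) * r ^ 2 + (b : ZMod p) * r + (c : ZMod p) := by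
  simp [polyMod, poly]

/-- **Dedekind–Kummer for `𝓞 K = ℤ[θ]`**: a prime `P` of `𝓞 K` above `p` is `(p, Q(θ))` for ANY
integer lift `Q` of the corresponding monic irreducible factor `Q̄` of `f mod p`, with residue
degree `deg Q̄`; and `Q̄` is a monic irreducible divisor of `f mod p` (Mathlib's
`NumberField.Ideal.primesOverSpanEquivMonicFactorsMod`). [cite: Marcus2018, Ch. 3, Thm. 27] -/
theorem exists_factor_of_mem_primesOver (hirr : Irreducible (polyQ a b c))
    (hθ : aeval θ (poly a b c) = 0) (h3 : finrank ℚ K = 3)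
    (hsq : ∀ r e : ℤ, disc a b c = r ^ 2 * e → 2 < |e| → IsUnit r)
    {p : ℕ} (hp : p.Prime) {P : Ideal (𝓞 K)}
    (hP : P ∈ primesOver (span {(p : ℤ)}) (𝓞 K)) :
    ∃ Qb : (ZMod p)[X], Irreducible Qb ∧ Qb.Monic ∧ Qb ∣ polyMod a b c p ∧
      P.inertiaDeg ℤ = Qb.natDegree ∧
      ∀ Q : ℤ[X], Q.map (Int.castRingHom (ZMod p)) = Qb →
        P = span {(p : 𝓞 K), aeval (thetaInt hθ) Q} := by
  haveI := Fact.mk hp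
  have hexp : ¬ p ∣ RingOfIntegers.exponent (thetaInt hθ) := by
    rw [exponent_thetaInt hirr hθ h3 hsq, Nat.dvd_one]
    exact hp.ne_one
  set e := NumberField.Ideal.primesOverSpanEquivMonicFactorsMod (K := K) hexp with he
  set Qb := e ⟨P, hP⟩ with hQb
  have hmem : (Qb : (ZMod p)[X]) ∈ RingOfIntegers.monicFactorsMod (thetaInt hθ) p := Qb.2
  have hmem' := hmem
  simp only [RingOfIntegers.monicFactorsMod, Multiset.mem_toFinset,
    minpoly_thetaInt hirr hθ] at hmem'
  have h0 : polyMod a b c p ≠ 0 := (monic_polyMod a b c p).ne_zero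
  obtain ⟨hirr', hmon, hdvd⟩ := (Polynomial.mem_normalizedFactors_iff h0).mp hmem'
  refine ⟨Qb, hirr', hmon, hdvd, ?_, ?_⟩
  · have := NumberField.Ideal.inertiaDeg_primesOverSpanEquivMonicFactorsMod_symm_apply' hexp hmem
    rwa [show (⟨(Qb : (ZMod p)[X]), hmem⟩ :
        RingOfIntegers.monicFactorsMod (thetaInt hθ) p) = Qb from Subtype.ext rfl,
      Equiv.symm_apply_apply] at this
  · intro Q hQ
    have hmemQ : Q.map (Int.castRingHom (ZMod p)) ∈
        RingOfIntegers.monicFactorsMod (thetaInt hθ) p := hQ ▸ hmem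
    have h1 := NumberField.Ideal.primesOverSpanEquivMonicFactorsMod_symm_apply_eq_span hexp hmemQ
    have h2 : (⟨Q.map (Int.castRingHom (ZMod p)), hmemQ⟩ :
        RingOfIntegers.monicFactorsMod (thetaInt hθ) p) = Qb := Subtype.ext hQ
    rw [h2, hQb, Equiv.symm_apply_apply] at h1
    exact h1

/-- **Inert primes are `(p)`**: if `f` has no root modulo `p` (so that the cubic `f mod p` is
irreducible), every prime of `𝓞 K` above `p` is `(p)`; in particular it is principal and has
residue degree `3`. [cite: Marcus2018, Ch. 3, Thm. 27] -/
theorem eq_span_of_no_root (hirr : Irreducible (polyQ a b c)) (hθ : aeval θ (poly a b c) = 0)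
    (h3 : finrank ℚ K = 3) (hsq : ∀ r e : ℤ, disc a b c = r ^ 2 * e → 2 < |e| → IsUnit r)
    {p : ℕ} (hp : p.Prime) {P : Ideal (𝓞 K)}
    (hP : P ∈ primesOver (span {(p : ℤ)}) (𝓞 K))
    (hnr : ∀ r : ZMod p, r ^ 3 + (a : ZMod p) * r ^ 2 + (b : ZMod p) * r + (c : ZMod p) ≠ 0) :
    P = span {(p : 𝓞 K)} := by
  haveI := Fact.mk hp
  obtain ⟨Qb, hirr', hmon, hdvd, -, hspan⟩ :=
    exists_factor_of_mem_primesOver hirr hθ h3 hsq hp hP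
  have hfirr : Irreducible (polyMod a b c p) := by
    refine irreducible_of_degree_le_three_of_not_isRoot
      (by rw [natDegree_polyMod]; decide) fun r hr => hnr r ?_
    rwa [IsRoot.def, eval_polyMod] at hr
  have hQb : Qb = polyMod a b c p :=
    eq_of_monic_of_associated hmon (monic_polyMod a b c p) (hirr'.associated_of_dvd hfirr hdvd)
  have h := hspan (poly a b c) (by rw [hQb]; rfl)
  rw [aeval_thetaInt hθ] at h
  rw [h, Ideal.span_insert, Ideal.span_singleton_eq_bot.mpr rfl, sup_bot_eq]

/-- **A degree-one prime with a certified generator is principal.** If `f` has exactly one root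
`r₀` modulo `p`, `p² > U ≥ p ^ f_P` (only residue degree one matters), and `α ∈ 𝓞 K` generates
`(p, θ - r₀)`, then a prime `P` above `p` with `p ^ f_P ≤ U` is principal.
[cite: Marcus2018, Ch. 3, Thm. 27] -/
theorem isPrincipal_of_unique_root (hirr : Irreducible (polyQ a b c))
    (hθ : aeval θ (poly a b c) = 0) (h3 : finrank ℚ K = 3)
    (hsq : ∀ r e : ℤ, disc a b c = r ^ 2 * e → 2 < |e| → IsUnit r)
    {p : ℕ} (hp : p.Prime) {P : Ideal (𝓞 K)}
    (hP : P ∈ primesOver (span {(p : ℤ)}) (𝓞 K)) {U : ℕ} (hle : p ^ P.inertiaDeg ℤ ≤ U)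
    {r₀ : ℤ}
    (hroot : ∀ r : ZMod p, r ^ 3 + (a : ZMod p) * r ^ 2 + (b : ZMod p) * r + (c : ZMod p) = 0 →
      r = (r₀ : ZMod p))
    (hU : U < p ^ 2) {α : 𝓞 K}
    (hα : span {(p : 𝓞 K), thetaInt hθ - (r₀ : 𝓞 K)} = span {α}) :
    Submodule.IsPrincipal P := by
  haveI := Fact.mk hp
  obtain ⟨Qb, hirr', hmon, hdvd, hdeg, hspan⟩ :=
    exists_factor_of_mem_primesOver hirr hθ h3 hsq hp hP
  have hQb1 : Qb.natDegree = 1 := by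
    have h1 : 1 ≤ Qb.natDegree := by
      rcases Nat.eq_zero_or_pos Qb.natDegree with h0 | h0
      · exact absurd (Polynomial.eq_one_of_monic_natDegree_zero hmon h0 ▸ isUnit_one)
          hirr'.not_isUnit
      · exact h0
    by_contra hne
    have h2 : 2 ≤ Qb.natDegree := by omega
    have : p ^ 2 ≤ p ^ P.inertiaDeg ℤ := Nat.pow_le_pow_right hp.pos (hdeg ▸ h2)
    omega
  have hQbeq : Qb = X + C (Qb.coeff 0) := hmon.eq_X_add_C hQb1
  have hc : -Qb.coeff 0 = (r₀ : ZMod p) := by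
    apply hroot
    have hr : (polyMod a b c p).IsRoot (-Qb.coeff 0) := by
      rw [← dvd_iff_isRoot, map_neg, sub_neg_eq_add, ← hQbeq]
      exact hdvd
    rwa [IsRoot.def, eval_polyMod] at hr
  have hQb' : (X - C r₀ : ℤ[X]).map (Int.castRingHom (ZMod p)) = Qb := by
    rw [Polynomial.map_sub, map_X, map_C, eq_intCast, ← hc, map_neg, sub_neg_eq_add, ← hQbeq]
  have hPeq := hspan (X - C r₀) hQb'
  simp only [map_sub, aeval_X, aeval_C, algebraMap_int_eq, Int.coe_castRingHom] at hPeq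
  rw [hα] at hPeq
  exact ⟨⟨α, by rw [hPeq, Ideal.submodule_span_eq]⟩⟩

end Root

end MonicCubic

end Literature.NumberTheory.NumberFields
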